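import Literature.Geometry.Kaehler.ComplexTorusPolarizedAutomorphismsLevelTwo
import Literature.Geometry.Kaehler.ComplexTorusPhiHFunctorial
import Literature.GroupTheory.ArithmeticGroups.PeriodicUnipotentModN
import HarnessLib

/-!
# Endomorphisms of finite order of a complex torus which are unipotent modulo `n` (Silverberg–Zarhin 1996, Thm. 8.1, over `ℂ`)

Layer `Literature/Geometry/Kaehler`, namespace `Literature.Geometry.Kaehler.ComplexTorus` (lane
`lit-hodgefound`, Layer A2, prover p38). Junction of
`GroupTheory/ArithmeticGroups/PeriodicUnipotentModN` (SILVERBERG–ZARHIN's `N(k)`, `R(k, n)`,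
Cor. 3.3 and Thm. 6.2 over `ℤ`) with the complex tori `X = E/Φ(ℤ^ι)` of the tree, sequel of
`ComplexTorusPolarizedAutomorphismsLevelTwo` (the case `k = 1`: Serre's lemma). Theorems only; no
definition, no named fact (D-0026).

A. Silverberg, Yu. G. Zarhin, *Variations on a theme of Minkowski and Serre*, J. Pure Appl. Algebra
111 (1996) 285–302, §8 **Theorem 8.1** (p. 297): "Suppose `G` is a commutative group scheme over a
field, which is an extension of an abelian variety by a torus, `n`, `k`, and `s` are positive
integers, `s` and `n` are relatively prime, `α ∈ End(G) ⊗_ℤ ℤ[1/s]`, `α` has finite multiplicative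
order, and `(α - 1)^k` is `0` on the scheme-theoretic kernel of multiplication by `n` on `G`. Then
`α^{R(k,n)} = 1`. In particular, if `n ∉ N(k)` then `α = 1`."

Here: `G = X` a complex torus (in particular any complex abelian variety), `s = 1`, over `ℂ`, for
holomorphic self-maps `f` fixing `0` (= endomorphisms, `f = ρ_r(A) = mapMatrix Φ Φ A`): the
hypothesis "`(α - 1)^k` is `0` on `X[n]`" reads `(f - id)^[k] x = 0` for all `x` with `n • x = 0`,
equivalently `(A - 1)^k ∈ n M(ℤ)` on the lattice (`exists_pow_sub_one_eq_smul_of_forall_torsion`),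
and Theorem 6.2 over `ℤ` (`SilverbergZarhin.matrix_pow_orderBound_eq_one`) gives
`f^[R(k,n)] = id` (`iterate_orderBound_eq_id`), `f = id` for `n ∉ N(k)`
(`eq_id_of_not_mem_exceptionalSet`), and the `k = 2` table (`n = 3`: `f³ = id`; `n = 4`: `f² = id`;
`n ≥ 5`: `f = id`). For automorphisms of a POLARISED abelian variety the finite-order hypothesis is
automatic (Lange Cor. 2.4.10, `isOfFinOrder_of_mem_polarizedAut`):
`pow_orderBound_eq_one_of_mem_polarizedAut`, `iterate_orderBound_eq_id_of_polarized`.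
-- TODO(general form): semi-abelian varieties over an arbitrary field and `α ∈ End(G) ⊗ ℤ[1/s]`
-- (the printed generality); only complex tori and `s = 1` are treated here.

## References

* [SilverbergZarhin1996] A. Silverberg, Yu. G. Zarhin, J. Pure Appl. Algebra 111 (1996), §8
  Thm. 8.1; Def. 2.1; Thm. 6.2.
* [Lange2023AbelianVarietiesComplex] H. Lange, Abelian Varieties over the Complex Numbers (2023),
  §2.4.1 Cor. 2.4.10 / 2.4.11.
-/

open Complex Module
open scoped Manifold ContDiff Matrix MatrixGroups

namespace Literature.Geometry.Kaehler

namespace ComplexTorus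

open Literature.GroupTheory.ArithmeticGroups
open Literature.GroupTheory.ArithmeticGroups.SilverbergZarhin

variable {ι : Type*} [Fintype ι] [DecidableEq ι] {E : Type*} [NormedAddCommGroup E] [NormedSpace ℂ E]
  (Φ : (ι → ℝ) ≃L[ℝ] E) {η : E [⋀^Fin 2]→L[ℝ] ℝ}

/-! ### §1 "`(α - 1)^k` is `0` on the kernel of multiplication by `n`", in the rational representation -/

/-- `f - id = ρ_r(A - 1)` for `f = ρ_r(A)`, and `(f - id)^[k] = ρ_r((A - 1)^k)`.
[cite: SilverbergZarhin1996, §8 Thm. 8.1 (the endomorphism `(α - 1)^k`)] -/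
theorem iterate_sub_id_eq_mapMatrix (A : Matrix ι ι ℤ) (k : ℕ) :
    (fun x : ComplexTorus Φ => mapMatrix Φ Φ A x - x)^[k] = mapMatrix Φ Φ ((A - 1) ^ k) := by
  have h1 : (fun x : ComplexTorus Φ => mapMatrix Φ Φ A x - x) = mapMatrix Φ Φ (A - 1) := by
    funext x
    have h := mapMatrix_add_matrix Φ Φ (A - 1) 1 x
    rw [sub_add_cancel, mapMatrix_one] at h
    rw [h, add_sub_cancel_right]
  rw [h1, iterate_mapMatrix]

/-- **"`(α - 1)^k` is `0` on the scheme-theoretic kernel of multiplication by `n`"** for a complex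
torus, read on the lattice: if `(f - id)^[k]` kills every `n`-torsion point of `X` (`f = ρ_r(A)`),
then `(A - 1)^k ∈ n M(ℤ)`. [cite: SilverbergZarhin1996, §8 Thm. 8.1 (proof: "`(α - 1)^k ∈ n𝒪`")]
[cite: Lange2023AbelianVarietiesComplex, §2.4.1 Cor. 2.4.11 (`X_n ⊂ ker` ⟹ divisible by `n`)] -/
theorem exists_pow_sub_one_eq_smul_of_forall_torsion {A : Matrix ι ι ℤ} {n k : ℕ} (hn : 0 < n)
    (h : ∀ x : ComplexTorus Φ, n • x = 0 → (fun y : ComplexTorus Φ => mapMatrix Φ Φ A y - y)^[k] x = 0) :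
    ∃ B : Matrix ι ι ℤ, (A - 1) ^ k = (n : ℤ) • B := by
  have h' : ∀ x : ComplexTorus Φ, n • x = 0 → mapMatrix Φ Φ ((A - 1) ^ k + 1) x = x := by
    intro x hx
    rw [mapMatrix_add_matrix, mapMatrix_one, ← iterate_sub_id_eq_mapMatrix, h x hx, zero_add]
  have hdvd := forall_dvd_sub_one_of_forall_torsion_eq Φ hn h'
  simp only [add_sub_cancel_right] at hdvd
  choose B hB using hdvd
  exact ⟨Matrix.of B, by ext i j; simp [hB i j, Matrix.smul_apply]⟩

/-! ### §2 Theorem 8.1 for complex tori -/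

/-- **Silverberg–Zarhin, Theorem 8.1 for complex tori (`s = 1`, over `ℂ`)**: a holomorphic
`f : X → X` with `f 0 = 0`, of finite order (`f^[N] = id`, `N > 0`), such that `(f - id)^[k]` is `0`
on the `n`-torsion `X[n]` (`n ≥ 1`), satisfies `f^[R(k,n)] = id`.
[cite: SilverbergZarhin1996, §8 Thm. 8.1] -/
theorem iterate_orderBound_eq_id {f : ComplexTorus Φ → ComplexTorus Φ}
    (hf : MDifferentiable 𝓘(ℂ, E) 𝓘(ℂ, E) f) (h0 : f 0 = 0) {N : ℕ} (hN : 0 < N) (hper : f^[N] = id)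
    {n k : ℕ} (hn : 0 < n)
    (hkill : ∀ x : ComplexTorus Φ, n • x = 0 → (fun y => f y - y)^[k] x = 0) :
    f^[orderBound k n] = id := by
  obtain ⟨A, -, -, -, rfl⟩ := exists_eq_mapMatrix_of_map_zero hf h0
  have hAN : A ^ N = 1 := (iterate_mapMatrix_eq_id_iff (Φ := Φ) A N).mp hper
  have hfin : IsOfFinOrder A := isOfFinOrder_iff_pow_eq_one.mpr ⟨N, hN, hAN⟩
  obtain ⟨B, hB⟩ := exists_pow_sub_one_eq_smul_of_forall_torsion Φ hn hkill
  rw [iterate_mapMatrix_eq_id_iff]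
  exact matrix_pow_orderBound_eq_one hfin hB

/-- **Theorem 8.1, "in particular"**: with `n ∉ N(k)`, such an `f` is the identity.
[cite: SilverbergZarhin1996, §8 Thm. 8.1] -/
theorem eq_id_of_not_mem_exceptionalSet {f : ComplexTorus Φ → ComplexTorus Φ}
    (hf : MDifferentiable 𝓘(ℂ, E) 𝓘(ℂ, E) f) (h0 : f 0 = 0) {N : ℕ} (hN : 0 < N) (hper : f^[N] = id)
    {n k : ℕ} (hn : 0 < n) (hnN : n ∉ exceptionalSet k)
    (hkill : ∀ x : ComplexTorus Φ, n • x = 0 → (fun y => f y - y)^[k] x = 0) : f = id := by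
  have h := iterate_orderBound_eq_id Φ hf h0 hN hper hn hkill
  rwa [orderBound_of_not_mem hnN, Function.iterate_one] at h

/-- **Theorem 8.1, `k = 2`, `n = 4`** (`R(2, 4) = 2`): if `(f - id)²` kills `X[4]` then `f ∘ f = id`.
[cite: SilverbergZarhin1996, §8 Thm. 8.1 and Def. 2.1] -/
theorem comp_self_eq_id_of_sq_sub_id_four_torsion {f : ComplexTorus Φ → ComplexTorus Φ}
    (hf : MDifferentiable 𝓘(ℂ, E) 𝓘(ℂ, E) f) (h0 : f 0 = 0) {N : ℕ} (hN : 0 < N) (hper : f^[N] = id)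
    (hkill : ∀ x : ComplexTorus Φ, 4 • x = 0 → (fun y => f y - y)^[2] x = 0) : f ∘ f = id := by
  have h := iterate_orderBound_eq_id Φ hf h0 hN hper (by norm_num : 0 < 4) hkill
  rwa [orderBound_two_four, Function.iterate_succ, Function.iterate_one] at h

/-- **Theorem 8.1, `k = 2`, `n = 3`** (`R(2, 3) = 3`): if `(f - id)²` kills `X[3]` then `f^[3] = id`.
[cite: SilverbergZarhin1996, §8 Thm. 8.1 and Def. 2.1] -/
theorem iterate_three_eq_id_of_sq_sub_id_three_torsion {f : ComplexTorus Φ → ComplexTorus Φ}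
    (hf : MDifferentiable 𝓘(ℂ, E) 𝓘(ℂ, E) f) (h0 : f 0 = 0) {N : ℕ} (hN : 0 < N) (hper : f^[N] = id)
    (hkill : ∀ x : ComplexTorus Φ, 3 • x = 0 → (fun y => f y - y)^[2] x = 0) : f^[3] = id := by
  have h := iterate_orderBound_eq_id Φ hf h0 hN hper (by norm_num : 0 < 3) hkill
  rwa [orderBound_two_three] at h

/-- **Theorem 8.1, `k = 2`, `n ≥ 5`** (`5, 6, … ∉ N(2)`): if `(f - id)²` kills `X[n]`, `n ≥ 5`, then
`f = id`. [cite: SilverbergZarhin1996, §8 Thm. 8.1 and Def. 2.1] -/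
theorem eq_id_of_sq_sub_id_torsion {f : ComplexTorus Φ → ComplexTorus Φ}
    (hf : MDifferentiable 𝓘(ℂ, E) 𝓘(ℂ, E) f) (h0 : f 0 = 0) {N : ℕ} (hN : 0 < N) (hper : f^[N] = id)
    {n : ℕ} (hn : 5 ≤ n) (hkill : ∀ x : ComplexTorus Φ, n • x = 0 → (fun y => f y - y)^[2] x = 0) :
    f = id := by
  have h := iterate_orderBound_eq_id Φ hf h0 hN hper (by omega : 0 < n) hkill
  rwa [orderBound_two_of_five_le hn, Function.iterate_one] at h

/-! ### §3 Automorphisms of polarised abelian varieties (finite order is automatic) -/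

/-- **Theorem 8.1 for `Aut(X, H)`, rational representation**: `A ∈ Aut(X, H)` (finite order by
Lange's Cor. 2.4.10) with `(A - 1)^k ∈ n M(ℤ)` satisfies `A^{R(k,n)} = 1`.
[cite: SilverbergZarhin1996, §8 Thm. 8.1] [cite: Lange2023AbelianVarietiesComplex, §2.4.1 Cor. 2.4.10] -/
theorem pow_orderBound_eq_one_of_mem_polarizedAut (h₁₁ : ∀ u v : E, η ![I • u, I • v] = η ![u, v])
    (hpos : ∀ u : E, u ≠ 0 → 0 < η ![I • u, u]) {A : Matrix ι ι ℤ} (hA : A ∈ polarizedAut Φ η)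
    {n k : ℕ} {B : Matrix ι ι ℤ} (hcong : (A - 1) ^ k = (n : ℤ) • B) : A ^ orderBound k n = 1 :=
  matrix_pow_orderBound_eq_one (isOfFinOrder_of_mem_polarizedAut Φ h₁₁ hpos hA) hcong

/-- **Theorem 8.1 for automorphisms of a polarised abelian variety, holomorphic-map form**: `η` of
type `(1,1)` with `η(iu, u) > 0`; `f` holomorphic, `f 0 = 0`, `η(df u, df v) = η(u, v)`; if
`(f - id)^[k]` kills `X[n]` (`n ≥ 1`) then `f^[R(k,n)] = id` — no finite-order hypothesis needed.
[cite: SilverbergZarhin1996, §8 Thm. 8.1] [cite: Lange2023AbelianVarietiesComplex, §2.4.1 Cor. 2.4.10 / 2.4.11] -/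
theorem iterate_orderBound_eq_id_of_polarized (h₁₁ : ∀ u v : E, η ![I • u, I • v] = η ![u, v])
    (hpos : ∀ u : E, u ≠ 0 → 0 < η ![I • u, u]) {f : ComplexTorus Φ → ComplexTorus Φ}
    (hf : MDifferentiable 𝓘(ℂ, E) 𝓘(ℂ, E) f) (h0 : f 0 = 0)
    (hη : ∀ u v : E,
      η ![mfderiv 𝓘(ℂ, E) 𝓘(ℂ, E) f 0 u, mfderiv 𝓘(ℂ, E) 𝓘(ℂ, E) f 0 v] = η ![u, v])
    {n k : ℕ} (hn : 0 < n)
    (hkill : ∀ x : ComplexTorus Φ, n • x = 0 → (fun y => f y - y)^[k] x = 0) :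
    f^[orderBound k n] = id := by
  obtain ⟨A, hA, rfl⟩ := exists_mem_polarizedAut_eq_mapMatrix Φ hf h0 hη
  obtain ⟨B, hB⟩ := exists_pow_sub_one_eq_smul_of_forall_torsion Φ hn hkill
  rw [iterate_mapMatrix_eq_id_iff]
  exact pow_orderBound_eq_one_of_mem_polarizedAut Φ h₁₁ hpos hA hB

/-- **Theorem 8.1 for automorphisms of a polarised abelian variety, "in particular"**: if
`(f - id)^[k]` kills `X[n]` with `n ∉ N(k)` then `f = id` (for `k = 1`, `n ≥ 3` this is Lange's
Cor. 2.4.11 / Serre's lemma, `ComplexTorusPolarizedAutomorphisms`).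
[cite: SilverbergZarhin1996, §8 Thm. 8.1] [cite: Lange2023AbelianVarietiesComplex, §2.4.1 Cor. 2.4.11] -/
theorem eq_id_of_polarized_of_not_mem_exceptionalSet (h₁₁ : ∀ u v : E, η ![I • u, I • v] = η ![u, v])
    (hpos : ∀ u : E, u ≠ 0 → 0 < η ![I • u, u]) {f : ComplexTorus Φ → ComplexTorus Φ}
    (hf : MDifferentiable 𝓘(ℂ, E) 𝓘(ℂ, E) f) (h0 : f 0 = 0)
    (hη : ∀ u v : E,
      η ![mfderiv 𝓘(ℂ, E) 𝓘(ℂ, E) f 0 u, mfderiv 𝓘(ℂ, E) 𝓘(ℂ, E) f 0 v] = η ![u, v])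
    {n k : ℕ} (hn : 0 < n) (hnN : n ∉ exceptionalSet k)
    (hkill : ∀ x : ComplexTorus Φ, n • x = 0 → (fun y => f y - y)^[k] x = 0) : f = id := by
  have h := iterate_orderBound_eq_id_of_polarized Φ h₁₁ hpos hf h0 hη hn hkill
  rwa [orderBound_of_not_mem hnN, Function.iterate_one] at h

end ComplexTorus

end Literature.Geometry.Kaehler
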